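import Mathlib
import Literature.Computability.AlgebraicComplexity.ArithCircuitProofs
import Literature.Computability.AlgebraicComplexity.ValiantClassesProofs
import Summits.ValiantsHypothesis.ValiantsHypothesis.Theorems.FifoMatchingNNDivisionHardLinearTransport
import HarnessLib

/-!
# Route FifoMatching — crux `NNDivisionHard` (stmt-ValiantsHypothesis-21181): the transported cofactor, explicitly —
# SHADOW-GENERIC cofactors transport to a monomial

Sequel of `…NNDivisionHardLinearTransport` (abstract linear transport `top_w P = ι(Q) · S` ⇒ every certificate `(h, P·h)`
restricts to `(g, Q·g)` at additive cost).  Here the transported cofactor is made explicit: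

* `exists_linear_transport_eq` — the transport with its defining identity `ι(g) = h^{top}|_{x_e := 1 off range ι}`;
* `aeval_eq_rename_monomial_of_agree` — if all monomials of `q` restrict to the same `μ` on the range of `ι`, the
  substitution collapses `q` to `ι(κ · x^μ)`, `κ` the (positive) sum of the coefficients;
* ★ `linear_transport_monomial` — **SHADOW-GENERIC COFACTORS**: if all monomials of the `w`-top component of `h ≠ 0` have the
  same restriction `μ` to the block, then `L₊(Q · x^μ) ≤ L₊(P · h) + 2` — the certificate transports to a MONOMIAL cofactor
  at the block scale (where monomial cofactors are handled by Jukna–Seiwert–Sergeev stripping).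

HONEST FRAMING: engine-level; stmt-21181 stays OPEN; nothing here bears on `NNNotVP` or on VP ≠ VNP (NOT proved).
References: Bürgisser 2000 Rem. 2.7 [Burgisser2000]; Jukna–Seiwert–Sergeev 2022 Thm 1 [JuknaSeiwertSergeev2022].
-/

noncomputable section

-- Sub = Summit single-conjunct layout: the duplicated namespace component is mandated by the tree.
set_option linter.dupNamespace false
set_option autoImplicit false

namespace Summit.ValiantsHypothesis.ValiantsHypothesis.Theorems.FifoMatching.NNDivisionHard.LinearTransport

open Finset MvPolynomial Literature.Computability.AlgebraicComplexity
open Summit.ValiantsHypothesis.ValiantsHypothesis.Theorems.ZeroOneTransfer.Negative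
  (topComponent topComponent_mul complexity_topComponent_le topComponent_ne_zero)
open scoped NNReal BigOperators

/-! ### The transported cofactor, explicitly; shadow-generic cofactors -/

/-- **LINEAR TRANSPORT, EXPLICIT FORM.**  As `linear_transport`, with the defining identity of the transported cofactor:
`ι(g) = h^{top}|_{x_e := a e}` for any substitution `a` keeping the variables in the range of `ι` and sending the others
to `1`. [cite: Burgisser2000, Rem. 2.7] -/
theorem exists_linear_transport_eq {σ τ : Type*} {ι : τ → σ} (hι : Function.Injective ι) (w : σ → ℕ)
    {P S : MvPolynomial σ ℝ≥0} {Q : MvPolynomial τ ℝ≥0}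
    (hface : topComponent w P = rename ι Q * S) (hS0 : S ≠ 0)
    (hS : ∀ m ∈ S.support, ∀ e ∈ m.support, e ∉ Set.range ι)
    (a : σ → MvPolynomial σ ℝ≥0) (hK : ∀ e, e ∈ Set.range ι → a e = X e) (hK' : ∀ e, e ∉ Set.range ι → a e = 1)
    {h : MvPolynomial σ ℝ≥0} (hh : h ≠ 0) :
    ∃ g : MvPolynomial τ ℝ≥0, g ≠ 0 ∧
      complexity (Q * g) ≤ complexity (P * h) + 1 ∧ complexity g ≤ complexity h ∧
      rename ι g = aeval a (topComponent w h) := by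
  classical
  have ha : ∀ e, a e = X e ∨ a e = 1 := fun e => by
    by_cases he : e ∈ Set.range ι
    · exact Or.inl (hK e he)
    · exact Or.inr (hK' e he)
  have hKι : ∀ t, a (ι t) = X (ι t) := fun t => hK _ ⟨t, rfl⟩
  have hq : topComponent w h ≠ 0 := topComponent_ne_zero w hh
  have hG0 : aeval a (topComponent w h) ≠ 0 := aeval_ne_zero_of_X_or_one a ha hq
  obtain ⟨g, hg⟩ := exists_rename_eq_of_vars_subset_range (aeval a (topComponent w h)) ι hι
    (vars_aeval_subset (Set.range ι) a hK hK' _)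
  have hren : ∀ R : MvPolynomial τ ℝ≥0, complexity (rename ι R) = complexity R :=
    fun R => complexity_rename_of_injective_holds hι R
  refine ⟨g, ?_, ?_, ?_, hg⟩
  · rintro rfl
    rw [map_zero] at hg
    exact hG0 hg.symm
  · have hκ : eval (fun _ => (1 : ℝ≥0)) S ≠ 0 := eval_one_ne_zero hS0
    have hSC : aeval a S = C (eval (fun _ => (1 : ℝ≥0)) S) := aeval_eq_C_of_support (Set.range ι) a hK' hS
    have H1 : complexity (aeval a (topComponent w (P * h))) ≤ complexity (P * h) :=
      (complexity_aeval_le_of_X_or_one a ha _).trans (complexity_topComponent_le w _)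
    have H2 : aeval a (topComponent w (P * h)) =
        rename ι (C (eval (fun _ => (1 : ℝ≥0)) S) * (Q * g)) := by
      rw [topComponent_mul, hface, map_mul, map_mul, aeval_rename_of_kept ι a hKι, hSC, ← hg, map_mul, map_mul,
        rename_C]
      ring
    rw [H2, hren] at H1
    have H3 : Q * g = C (eval (fun _ => (1 : ℝ≥0)) S)⁻¹ * (C (eval (fun _ => (1 : ℝ≥0)) S) * (Q * g)) := by
      rw [← mul_assoc, ← C_mul, inv_mul_cancel₀ hκ, C_1, one_mul]
    calc complexity (Q * g)
        = complexity (C (eval (fun _ => (1 : ℝ≥0)) S)⁻¹ * (C (eval (fun _ => (1 : ℝ≥0)) S) * (Q * g))) := by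
          rw [← H3]
      _ ≤ complexity (C (eval (fun _ => (1 : ℝ≥0)) S)⁻¹ : MvPolynomial τ ℝ≥0) +
            complexity (C (eval (fun _ => (1 : ℝ≥0)) S) * (Q * g)) + 1 := complexity_mul_le_holds _ _
      _ = complexity (C (eval (fun _ => (1 : ℝ≥0)) S) * (Q * g)) + 1 := by rw [complexity_C_holds, zero_add]
      _ ≤ complexity (P * h) + 1 := by gcongr
  · calc complexity g = complexity (rename ι g) := (hren g).symm
      _ = complexity (aeval a (topComponent w h)) := by rw [hg]
      _ ≤ complexity (topComponent w h) := complexity_aeval_le_of_X_or_one a ha _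
      _ ≤ complexity h := complexity_topComponent_le w h

/-- If all monomials of `q` have the SAME restriction `μ` to the range of `ι`, the substitution collapses `q` to the single
monomial `ι(x^μ)` with coefficient the sum of the coefficients of `q`. [folklore] -/
theorem aeval_eq_rename_monomial_of_agree {σ τ : Type*} {ι : τ → σ} (hι : Function.Injective ι)
    (a : σ → MvPolynomial σ ℝ≥0) (hK : ∀ e, e ∈ Set.range ι → a e = X e) (hK' : ∀ e, e ∉ Set.range ι → a e = 1)
    {q : MvPolynomial σ ℝ≥0} (μ : τ →₀ ℕ) (hgen : ∀ m ∈ q.support, ∀ t : τ, m (ι t) = μ t) :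
    aeval a q = rename ι (monomial μ (eval (fun _ => (1 : ℝ≥0)) q)) := by
  classical
  have hmono : ∀ m ∈ q.support, ∀ c : ℝ≥0, aeval a (monomial m c) = rename ι (monomial μ c) := by
    intro m hm c
    have hν : Finsupp.mapDomain ι μ = m.filter (fun e => e ∈ Set.range ι) := by
      ext e
      by_cases he : e ∈ Set.range ι
      · obtain ⟨t, rfl⟩ := he
        rw [Finsupp.mapDomain_apply hι, Finsupp.filter_apply_pos _ _ ⟨t, rfl⟩, hgen m hm t]
      · rw [Finsupp.mapDomain_notin_range _ _ he, Finsupp.filter_apply_neg _ _ he]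
    rw [aeval_monomial, rename_monomial, algebraMap_eq, Finsupp.prod,
      ← Finset.prod_filter_mul_prod_filter_not m.support (fun e => e ∈ Set.range ι)]
    have h1 : ∏ e ∈ m.support.filter (fun e => ¬ e ∈ Set.range ι), a e ^ m e = 1 :=
      Finset.prod_eq_one fun e he => by rw [hK' e (Finset.mem_filter.1 he).2, one_pow]
    have h2 : ∏ e ∈ m.support.filter (fun e => e ∈ Set.range ι), a e ^ m e =
        ∏ e ∈ m.support.filter (fun e => e ∈ Set.range ι), X e ^ m e :=
      Finset.prod_congr rfl fun e he => by rw [hK e (Finset.mem_filter.1 he).2]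
    rw [h1, h2, mul_one, monomial_eq, hν, Finsupp.prod, Finsupp.support_filter]
    refine congrArg _ (Finset.prod_congr rfl fun e he => ?_)
    rw [Finsupp.filter_apply_pos _ _ (Finset.mem_filter.1 he).2]
  conv_lhs => rw [q.as_sum]
  rw [map_sum, Finset.sum_congr rfl fun m hm => hmono m hm (coeff m q), ← map_sum, ← map_sum, eval_eq]
  simp only [one_pow, Finset.prod_const_one, mul_one]

/-- ★ **SHADOW-GENERIC COFACTORS.**  In the situation of `linear_transport`: if all monomials of the `w`-top component of
the cofactor `h ≠ 0` have the SAME restriction `μ` to the block (the `w`-top face of `Newt(h)` projects to a point on the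
range of `ι`), then the transported cofactor is the monomial `x^μ` (times a positive constant), so
`L₊(Q · x^μ) ≤ L₊(P · h) + 2`. [cite: Burgisser2000, Rem. 2.7] -/
theorem linear_transport_monomial {σ τ : Type*} {ι : τ → σ} (hι : Function.Injective ι) (w : σ → ℕ)
    {P S : MvPolynomial σ ℝ≥0} {Q : MvPolynomial τ ℝ≥0}
    (hface : topComponent w P = rename ι Q * S) (hS0 : S ≠ 0)
    (hS : ∀ m ∈ S.support, ∀ e ∈ m.support, e ∉ Set.range ι)
    {h : MvPolynomial σ ℝ≥0} (hh : h ≠ 0) (μ : τ →₀ ℕ)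
    (hgen : ∀ m ∈ (topComponent w h).support, ∀ t : τ, m (ι t) = μ t) :
    complexity (Q * monomial μ 1) ≤ complexity (P * h) + 2 := by
  classical
  let a : σ → MvPolynomial σ ℝ≥0 := fun e => if e ∈ Set.range ι then X e else 1
  have hK : ∀ e, e ∈ Set.range ι → a e = X e := fun e he => by simp only [a, if_pos he]
  have hK' : ∀ e, e ∉ Set.range ι → a e = 1 := fun e he => by simp only [a, if_neg he]
  obtain ⟨g, -, hb, -, hg⟩ := exists_linear_transport_eq hι w hface hS0 hS a hK hK' hh
  set κ := eval (fun _ => (1 : ℝ≥0)) (topComponent w h) with hκdef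
  have hκ : κ ≠ 0 := eval_one_ne_zero (topComponent_ne_zero w hh)
  have hgm : g = monomial μ κ :=
    rename_injective ι hι (by rw [hg, aeval_eq_rename_monomial_of_agree hι a hK hK' μ hgen])
  have H3 : Q * monomial μ 1 = C κ⁻¹ * (Q * g) := by
    rw [hgm, mul_left_comm, C_mul_monomial, inv_mul_cancel₀ hκ]
  calc complexity (Q * monomial μ 1) = complexity (C κ⁻¹ * (Q * g)) := by rw [H3]
    _ ≤ complexity (C κ⁻¹ : MvPolynomial τ ℝ≥0) + complexity (Q * g) + 1 := complexity_mul_le_holds _ _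
    _ = complexity (Q * g) + 1 := by rw [complexity_C_holds, zero_add]
    _ ≤ complexity (P * h) + 1 + 1 := by gcongr
    _ = complexity (P * h) + 2 := rfl

end Summit.ValiantsHypothesis.ValiantsHypothesis.Theorems.FifoMatching.NNDivisionHard.LinearTransport

end
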